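import Mathlib.Algebra.Algebra.Subalgebra.Basic
import Literature.AlgebraicGeometry.HodgeTheory.MotivatedClasses
import Literature.AlgebraicGeometry.Hyperkaehler.LooijengaLuntsVerbitsky
import HarnessLib

/-!
# The `sl(2)`-partner `Λ` of a hard-Lefschetz class exists and lies in the algebra generated by `L` and the Lefschetz involution `*_L` (André 1996, §1.1–1.2, Prop. 1.2; Kleiman 1968, 1.4.4–1.4.6) — NAMED FACT

Layer `Literature/AlgebraicGeometry/HodgeTheory`.  CITE record for the cell `hodge-kum4` (ladder
HodgeAV, rung H3; cell home run/shared/lean/pub/hodge-kum4/; the planner's support item S1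
`PolarizationHasDualLefschetz` of HOME/plan/Statement.lean and its request STATUS
2026-08-25T19:26:14Z): for a smooth projective `X` of dimension `d` and a class `η ∈ H²` with the
hard Lefschetz property, (i) the operator `ᶜΛ` defined through the Lefschetz decomposition makes
`(ᶜΛ, h, L)` an `sl₂`-triplet (André §1.2 first sentence; Kleiman 1.4.6), and (ii) the subalgebras
`ℚ[L, *_L]` and `ℚ[L, ᶜΛ]` of `End H*(X)` coincide (André Prop. 1.2; Kleiman 1.4.4–1.4.5), so the
`sl₂`-partner of `L` is a non-commutative polynomial in `L` and `*_L`.  With the tree's named fact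
`StandardConjectureBStar` for `Kum⁴`-type (`Hyperkaehler.Foster2024_lefschetzStandard_kummerType_prime`,
"`*_L` is an algebraic correspondence") and the composition/linear-combination closure of
`IsAlgebraicCorrespondence`, (ii) is exactly "`Λ_η` is an algebraic correspondence" — the only use of
`B(X)` on the cell's route (lemma L2).

## Source (read: held text `paper:doi-10-1007-bf02698643`, PDF pp. 7–9)

Y. André, *Pour une théorie inconditionnelle des motifs*, Publ. Math. IHÉS 83 (1996) 5–49
[`Andre1996Motifs`; REFEREED], §1.1 (p. 7 of the PDF), verbatim (OCR-normalised): "Soit `X` un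
`K`-schéma projectif lisse purement de dimension `d`, muni de la classe `η = c₁(𝓛_X) ∈ H²(X)` d'un
faisceau inversible ample `𝓛_X` et soit `L = L_η` l'opérateur de Lefschetz sur `H*(X)` défini par le
cup-produit avec `η`. On dit que `X` vérifie le théorème de Lefschetz fort (relativement à `H*` et `η`)
si pour tout `i ≤ d`, `L^{d-i} : Hⁱ(X) → H^{2d-i}(X)` est un isomorphisme. On a alors pour tout `j` la
décomposition de Lefschetz : `Hʲ(X) = ⊕ Lᵏ P^{j-2k}(X)` […] Cette décomposition permet de définir
l'opérateur de Hodge « abstrait » `ᶜΛ` par la formule suivante : si `x = Σ Lᵏ x_{j-2k}` est la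
décomposition de Lefschetz de `x ∈ Hʲ(X)`, alors `ᶜΛ x = Σ k(d - j + k + 1) L^{k-1} x_{j-2k}` […] On
définit aussi les involutions de Lefschetz et de Hodge respectivement par les formules :
`*_L x = Σ L^{d-j+k} x_{j-2k}`, […]"; Remarque (p. 8): "Si `K ⊂ ℂ` et `H*` est la cohomologie de
Betti, le théorème de Lefschetz fort est vrai"; §1.2 (p. 8), verbatim: "Notons `πʲ_X` le projecteur de
Künneth sur `Hʲ(X)`, et posons `h = Σ_{j=0}^{2d} (d - j) πʲ_X`. Alors `(ᶜΛ, h, L)` forme un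
`sl₂`-triplet au sens de Bourbaki, Lie VIII 11.1 : `[h, ᶜΛ] = 2ᶜΛ`, `[h, L] = -2L`, `[ᶜΛ, L] = h`,
cf. [Kl68] 1.4.6. […] **Proposition 1.2.** — Les sous-algèbres `ℚ[L, *_L]`, `ℚ[L, *_H]`,
`ℚ[L, *_L L *_L]`, `ℚ[L, ᶜΛ]` de `End H*(X)` sont égales et contiennent les projecteurs de Künneth.
[…] *Preuve.* — Pour la première assertion, on renvoie à [Kl68] 1.4.4, 1.4.5."
(S. Kleiman, *Algebraic cycles and the Weil conjectures*, in: Dix exposés sur la cohomologie des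
schémas, North-Holland 1968, §1.4 [`Kleiman1968AlgebraicCycles`].)

## Rendering (tree carriers) and faithfulness

* `H*(X)`: the tree's total cohomology `Hyperkaehler.totalCohomology ℂ X(ℂ) = ⨁ₖ Hᵏ(X(ℂ); ℂ)`
  (file `Hyperkaehler/LooijengaLuntsVerbitsky`), `L = Hyperkaehler.totalLefschetz η`, and the
  `sl₂`-partner condition `Hyperkaehler.IsDualLefschetz d η Λ` = Mathlib `IsSl2Triple h L Λ` with the
  tree's `h = degreeOperator ℂ X(ℂ) d` (multiplication by `k - d` on `Hᵏ`).  SIGN DICTIONARY: André's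
  `h` is `Σ (d - j) πʲ = -h_tree` and his triplet reads `[ᶜΛ, L] = h_André`, i.e. `[L, ᶜΛ] = h_tree`,
  `[h_tree, L] = 2L`, `[h_tree, ᶜΛ] = -2ᶜΛ` — exactly `IsSl2Triple (degreeOperator) (totalLefschetz η) ᶜΛ`;
  so André's `ᶜΛ` IS a dual Lefschetz operator in the tree's sense (and the unique one, by the tree's
  `Algebra/Lie/Sl2PartnerUnique`).
* `*_L`: the tree's `HodgeTheory.lefschetzInvolution hL hab : Hᵃ → Hᵇ` (`a + b = 2d`; file
  `HodgeTheory/MotivatedClasses`) IS André's displayed `*_L x = Σₖ L^{d-j+k} x_{j-2k}`: for `j ≤ d`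
  this is `L^{d-j}` on all of `Hʲ`, for `j > d` the inverse of `L^{j-d}` — the two defining clauses of
  `lefschetzInvolution` (`lefschetzInvolution_apply_of_le` and the `dif_neg` branch); NORMALISATION
  CHECKED at the page (asked by the planner): no constants, no signs (Kleiman's `⋆` and André's `*_H`
  differ from it by signs; they are not used here).  Assembled on `H*` as `totalLefschetzInvolution hL`
  (this file; `0` on the summands `Hᵃ`, `a > 2d`, which vanish for `X` smooth projective).
* "`ℚ[L, *_L] = ℚ[L, ᶜΛ]`" is rendered by its consequence `ᶜΛ ∈` the `ℂ`-subalgebra of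
  `End_ℂ H*(X(ℂ); ℂ)` generated by `L` and `*_L` (`Algebra.adjoin ℂ {L, *_L}`; `ℂ`- rather than
  `ℚ`-coefficients is WEAKER than print and is what the consumer needs, the tree's
  `IsAlgebraicCorrespondence` being a `ℂ`-span notion).
* Hypotheses: `Motives.IsSmoothProjective d X` (so `Hᵏ(X(ℂ); ℂ) = 0` for `k > 2d` and all `Hᵏ` are
  finite-dimensional — André's "projectif lisse purement de dimension `d`"), the hard Lefschetz
  property of `η` in dimension `d` (`HasHardLefschetzProperty η d`, André's standing assumption; his
  §1.1–1.2 are formal consequences of the Lefschetz decomposition and do not use that `η` is ample or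
  rational), and `0 < d`: for `d = 0` (`X` a point) `h = 0` and Mathlib's `IsSl2Triple` (which demands
  `h ≠ 0`) has no instance, whereas for `d ≥ 1`, `h = -d ≠ 0` on `H⁰(X(ℂ); ℂ) ≅ ℂ`.  The planner's
  `PolarizationHasDualLefschetz` (`∀ n X η, IsPolarizationClass n X η → HasDualLefschetz n η`) therefore
  needs `Motives.IsSmoothProjective n X` and `0 < n` added (told on STATUS); with them it is the
  corollary `.hasDualLefschetz_of_isPolarizationClass` below.
* NOT asserted: the equalities with `ℚ[L, *_H]`, the matrix-algebra structure `⊕ M_{i+1}(ℚ)` and the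
  transposition statement of Prop. 1.2; uniqueness of `Λ` (a tree theorem elsewhere).

## Content

* DEFINITION `totalLefschetzInvolution hL` (+ unfolding lemmas `totalLefschetzInvolution_ofDegree`,
  `totalLefschetzInvolution_ofDegree_of_lt`), with bodies, PROVED;
* NAMED FACT `Andre1996_dualLefschetz_mem_adjoin_lefschetzInvolution`;
* PROVED corollaries `.hasDualLefschetz` and `.hasDualLefschetz_of_isPolarizationClass` (the
  planner's S1 with the two missing hypotheses made explicit).
-/

noncomputable section

open CategoryTheory DirectSum
open Literature.AlgebraicTopology.SingularHomology Literature.Geometry.Kaehler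
open Literature.AlgebraicGeometry.Hyperkaehler

namespace Literature.AlgebraicGeometry.HodgeTheory

variable {X : Motives.SchemeOver ℂ} {η : complexBetti X 2} {d : ℕ}

/-- **André's Lefschetz involution on total cohomology**: `*_L` on `H*(X(ℂ); ℂ) = ⨁ₐ Hᵃ`, acting on
`Hᵃ`, `a ≤ 2d`, by the tree's `lefschetzInvolution hL : Hᵃ → H^{2d-a}` ("donnée en chaque degré par
l'isomorphisme de Lefschetz ou son inverse") and by `0` on the summands `a > 2d` (zero for `X` smooth
projective of dimension `d`). [cite: Andre1996Motifs, §1.1 (pp. 10–11, the displayed formula for *_L) and §0.2 (p. 7)] -/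
def totalLefschetzInvolution (hL : HasHardLefschetzProperty η d) :
    Module.End ℂ (totalCohomology ℂ (Motives.ComplexPoints X)) :=
  toModule ℂ ℕ (totalCohomology ℂ (Motives.ComplexPoints X)) fun a ↦
    if h : a ≤ 2 * d then
      ofDegree ℂ (Motives.ComplexPoints X) (2 * d - a) ∘ₗ lefschetzInvolution hL (show a + (2 * d - a) = 2 * d by omega)
    else 0

/-- Unfolding in degrees `a ≤ 2d`: `*_L (x in degree a) = lefschetzInvolution hL x in degree 2d - a`.
[cite: Andre1996Motifs, §1.1 (pp. 10–11)] -/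
theorem totalLefschetzInvolution_ofDegree (hL : HasHardLefschetzProperty η d) {a : ℕ} (ha : a ≤ 2 * d)
    (x : complexBetti X a) :
    totalLefschetzInvolution hL (ofDegree ℂ (Motives.ComplexPoints X) a x) =
      ofDegree ℂ (Motives.ComplexPoints X) (2 * d - a)
        (lefschetzInvolution hL (show a + (2 * d - a) = 2 * d by omega) x) := by
  simp only [totalLefschetzInvolution, toModule_lof, dif_pos ha, LinearMap.coe_comp, Function.comp_apply]

/-- Unfolding in degrees `a > 2d`: `*_L` is `0` there (these summands vanish for `X` smooth projective
of dimension `d`). [cite: Andre1996Motifs, §1.1 (pp. 10–11)] -/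
theorem totalLefschetzInvolution_ofDegree_of_lt (hL : HasHardLefschetzProperty η d) {a : ℕ}
    (ha : 2 * d < a) (x : complexBetti X a) :
    totalLefschetzInvolution hL (ofDegree ℂ (Motives.ComplexPoints X) a x) = 0 := by
  simp only [totalLefschetzInvolution, toModule_lof, dif_neg (not_le.mpr ha), LinearMap.zero_apply]

/-- **André 1996 §1.1–1.2 with Prop. 1.2 (Kleiman 1968, 1.4.4–1.4.6): for a hard-Lefschetz class `η`
on a smooth projective `X` of dimension `d ≥ 1`, the `sl₂`-partner `ᶜΛ` of `L_η` exists and lies in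
the subalgebra of `End H*(X)` generated by `L_η` and the Lefschetz involution `*_L`** ("`(ᶜΛ, h, L)`
forme un `sl₂`-triplet"; "Les sous-algèbres `ℚ[L, *_L]`, …, `ℚ[L, ᶜΛ]` de `End H*(X)` sont égales").
Rendering: `∃ Λ`, `Hyperkaehler.IsDualLefschetz d η Λ` (Mathlib `IsSl2Triple` with the tree's degree
operator; sign dictionary in the module docstring) `∧ Λ ∈ Algebra.adjoin ℂ {L_η, *_L}` on
`H*(X(ℂ); ℂ)` (`ℂ`-coefficients: weaker than the printed `ℚ`).  Hypotheses `IsSmoothProjective d X`,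
`HasHardLefschetzProperty η d` (André's standing assumptions; `η` ample is not used by §1.1–1.2) and
`0 < d` (Mathlib's `IsSl2Triple` needs `h ≠ 0`).  A THEOREM in print (REFEREED: Publ. IHÉS 1996;
unproved in the tree). [cite: Andre1996Motifs, §1.1 pp. 10–11 (definition of ᶜΛ and *_L), §1.2 p. 11 first sentence (sl₂-triplet) and Prop. 1.2 p. 11 (ℚ[L,*_L] = ℚ[L,ᶜΛ]; proof p. 12 via [Kl68] 1.4.4–1.4.5); PDF pp. 7–9 of the held text]
[cite: Kleiman1968AlgebraicCycles, §1.4, 1.4.4–1.4.6] -/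
def Andre1996_dualLefschetz_mem_adjoin_lefschetzInvolution : Prop :=
  ∀ (d : ℕ), 0 < d → ∀ ⦃X : Motives.SchemeOver ℂ⦄, Motives.IsSmoothProjective d X →
    ∀ (η : complexBetti X 2) (hL : HasHardLefschetzProperty η d),
      ∃ Λ : Module.End ℂ (totalCohomology ℂ (Motives.ComplexPoints X)),
        IsDualLefschetz d η Λ ∧
          Λ ∈ Algebra.adjoin ℂ
            ({totalLefschetz η, totalLefschetzInvolution hL} :
              Set (Module.End ℂ (totalCohomology ℂ (Motives.ComplexPoints X))))

namespace Andre1996_dualLefschetz_mem_adjoin_lefschetzInvolution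

/-- **A hard-Lefschetz class has a dual Lefschetz operator** (`HasDualLefschetz`, "by Jacobson–Morozov",
Looijenga–Lunts §1 p. 4 — here from André's explicit `ᶜΛ`). [cite: Andre1996Motifs, §1.2 p. 11 first sentence]
[cite: LooijengaLunts1997, §1 p. 4] -/
theorem hasDualLefschetz (h : Andre1996_dualLefschetz_mem_adjoin_lefschetzInvolution) {d : ℕ}
    (hd : 0 < d) {X : Motives.SchemeOver ℂ} (hX : Motives.IsSmoothProjective d X)
    (η : complexBetti X 2) (hL : HasHardLefschetzProperty η d) : HasDualLefschetz d η := by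
  obtain ⟨Λ, hΛ, -⟩ := h d hd hX η hL
  exact ⟨Λ, hΛ⟩

/-- **The planner's S1 `PolarizationHasDualLefschetz`, with its two implicit hypotheses made explicit**
(`X` smooth projective of dimension `n`, `0 < n`): a polarisation class has an `sl₂` dual Lefschetz
operator. [cite: Andre1996Motifs, §1.2 p. 11 first sentence] [cite: LooijengaLunts1997, §1 p. 4] -/
theorem hasDualLefschetz_of_isPolarizationClass (h : Andre1996_dualLefschetz_mem_adjoin_lefschetzInvolution)
    {n : ℕ} (hn : 0 < n) {X : Motives.SchemeOver ℂ} (hX : Motives.IsSmoothProjective n X)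
    {η : complexBetti X 2} (hη : IsPolarizationClass n X η) : HasDualLefschetz n η :=
  h.hasDualLefschetz hn hX η hη.hasHardLefschetz

end Andre1996_dualLefschetz_mem_adjoin_lefschetzInvolution

end Literature.AlgebraicGeometry.HodgeTheory

end
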